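import Literature.AlgebraicGeometry.Resolution.KollarSurfaceMarkedOrderReductionTame
import Literature.AlgebraicGeometry.Resolution.KollarBoundarySeparationTameSurface
import Literature.AlgebraicGeometry.Resolution.KollarBoundaryDivisorReduction
import Literature.AlgebraicGeometry.Resolution.KollarHypersurfaceTriple
import HarnessLib

/-!
# Kollár's Lemma 3.102 on a threefold triple in the tame regime: moving the cosupport off a boundary surface (Kollár 2007, Lemma 3.102; first threefold step)

Topic: `Literature/AlgebraicGeometry/Resolution`. J. Kollár, *Lectures on Resolution of
Singularities* (2007), Lemma 3.102 (pp. 169–170 of the held copy): "`𝓑𝓓_{n,m,j}(X, I, E) :=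
τ_* 𝓑𝓜𝓞_{n-1,m}(S, I_0|_S, m, E_S)`" — blow up `Z_{-1}` (the components of `E^j` inside the
cosupport), then push forward an order reduction of the restricted (coefficient) marked ideal on
the birational transform `S` of `E^j`; conclusion (1): "`cosupp(I_r, m) ∩ Π_*^{-1} E^j = ∅`".

`KollarBoundarySeparationTameSurface.lean` does this on SURFACES in the tame regime (the
lower-dimensional order reduction being the characteristic-free one for curves). This file does
it on THREEFOLD triples `T : Kollar2007.Triple k 3` (Notation 3.64) over a perfect field of
characteristic `p`: the restricted coefficient marked ideal `(S, 𝒞(I_0, b)|_S, (E_0 ∖ S)|_S, b!)`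
lives on the SURFACE triple `T_0.hypersurfaceTriple` (`KollarHypersurfaceTriple.lean`,
characteristic-free), where Kollár's Thm. 3.69 for an ARBITRARY marking is now available in the
tame regime (`Kollar2007.Triple.exists_isResolutionOf_marked_two'`,
`KollarSurfaceMarkedOrderReductionTame.lean`: thresholds `p > max-ord` of the restricted ideal
and `p > b!·(b! - 1)`), and the push-forward is the tree's going up (`1, …, b-1` units).

* `Kollar2007.Triple.hasLocalCoordinates_kHom_of_perfectField` — local coordinates of a triple
  over a perfect field;
* **`Kollar2007.Triple.exists_separate_boundary_member_three`** — for `T` a threefold triple,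
  `1 ≤ b < p` (or `p = 0`), `D ∈ E`, and a bound `μ` on the orders of the restricted coefficient
  ideal on the birational transform of `V(D)` with `p = 0 ∨ (μ < p ∧ b!(b!-1) < p)`: a blow-up
  sequence `t` admissible for `(X, I, E, b)` at whose top the cosupport is disjoint from the
  birational transform `t_*^{-1} D` (Lemma 3.102 (1)) — the honest threefold threshold of this
  step recorded as a hypothesis.

## Sources

* J. Kollár, *Lectures on Resolution of Singularities*, Ann. of Math. Stud. 166 (2007):
  Lemma 3.102 with its proof (pp. 169–170), Cor. 3.85, 3.30.3, Notation 3.64. [Kollar2007]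
* E. Bierstone, D. Grigoriev, P. Milman, J. Włodarczyk, arXiv:1206.3090: Def. 3.1.3,
  Lemma 3.9.4, Thm. 8.0.4. [BierstoneGrigorievMilmanWlodarczyk2011]
-/

noncomputable section

open CategoryTheory CategoryTheory.Limits AlgebraicGeometry TopologicalSpace IsLocalRing
  Scheme.IdealSheafData

namespace Literature.AlgebraicGeometry.Resolution

universe u

namespace Kollar2007.Triple

variable {k : Type u} [Field k] {n : ℕ}

/-- Triples over a perfect field have local coordinates with dual derivations (regular over a
perfect field is smooth, Stacks 0B8X; then étale coordinates, Kollár 3.64 "local coordinates").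
[cite: StacksProject, Tag 0B8X] [cite: Kollar2007, Notation 3.64 (p. 148)] -/
theorem hasLocalCoordinates_kHom_of_perfectField [PerfectField k] (T : Triple k n) :
    HasLocalCoordinates T.kHom := by
  letI : T.X.Over (Spec (.of k)) := ⟨T.struct⟩
  haveI : LocallyOfFiniteType (T.X ↘ Spec (.of k)) := T.locallyOfFiniteType
  have hs : Smooth T.struct := smooth_of_isRegular_of_perfectField _ T.isRegular
  haveI : Smooth (T.X ↘ Spec (.of k)) := hs
  exact hasLocalCoordinates_overHom k T.X

open Classical in
/-- **Kollár's Lemma 3.102 on a threefold triple, tame regime — existence.** Let `T = (X, I, E)`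
be a triple of Notation 3.64 of dimension `3` over a perfect field `k` of characteristic `p`
(`p = 0` allowed), `1 ≤ b`, `p = 0 ∨ b < p`, and `D ∈ E`. Let `Z_{-1}` be the boundary centre of
`D` (`Kollar2007.boundaryCentre`), `π` its blowing up, `I_0 = (π^*I : 𝓘_exc^b)`, `S = V(D_0)` the
birational transform of `V(D)`, and assume the orders of the restricted coefficient ideal
`𝒞(I_0, b)|_S` are `≤ μ` with `p = 0 ∨ (μ < p ∧ b!·(b!-1) < p)`. Then there is a blow-up sequence
`t` admissible for `(X, I, E, b)` whose final cosupport is disjoint from the birational transform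
of `D`: `Z_{-1}` followed by the push-forward of Kollár's order reduction (Thm. 3.69, marking
`b!`, tame) of `(S, 𝒞(I_0, b)|_S, (E_0 ∖ S)|_S, b!)` on the surface triple `S`.
[cite: Kollar2007, Lemma 3.102 (pp. 169–170), Cor. 3.85, Thm. 3.69, Notation 3.64]
[cite: BierstoneGrigorievMilmanWlodarczyk2011, Lemma 3.9.4, Thm. 8.0.4] -/
theorem exists_separate_boundary_member_three (p : ℕ) [CharP k p] [PerfectField k] (T : Triple k 3)
    {b : ℕ} (hb : 1 ≤ b) (hbp : p = 0 ∨ b < p) {D : T.X.IdealSheafData} (hD : D ∈ T.boundary) {μ : ℕ}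
    (hμ : ∀ s : (strictTransformIdeal (blowup.π (boundaryCentre T.kHom T.ideal D b))
        (boundaryCentre T.kHom T.ideal D b) D).subscheme,
      idealOrder ((((T.marked b).transform (blowup.π (boundaryCentre T.kHom T.ideal D b))
        (boundaryCentre T.kHom T.ideal D b)).coeffRestrict
          ((blowup.π (boundaryCentre T.kHom T.ideal D b)).appTop.hom.comp T.kHom)
          (strictTransformIdeal (blowup.π (boundaryCentre T.kHom T.ideal D b))
            (boundaryCentre T.kHom T.ideal D b) D)).ideal) s ≤ μ)
    (hp : p = 0 ∨ (μ < p ∧ b.factorial * (b.factorial - 1) < p)) :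
    ∃ t : CentreSeq T.X, t.IsAdmissibleFor (T.marked b) ∧
      ((t.transformDivisor D).support : Set t.top) ∩ (t.transformMarked (T.marked b)).support = ∅ := by
  haveI : IsLocallyNoetherian T.X := T.isLocallyNoetherian
  letI : T.X.Over (Spec (.of k)) := ⟨T.struct⟩
  set φ := T.kHom with hφ
  have hXd : HasFinitePresentationDifferentials φ := by
    have := T.hasFinitePresentationDifferentials_of_hom (𝟙 T.X); rwa [id_appTop_comp] at this
  have hc : HasLocalCoordinates φ := T.hasLocalCoordinates_kHom_of_perfectField
  have hunitst : ∀ (x : T.X) (l : ℕ), 0 < l → l < b → IsUnit ((l : ℕ) : T.X.presheaf.stalk x) :=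
    fun x l hl hlb => isUnit_natCast_stalk_of_char k T.X p (hbp.imp id le_of_lt) x l hl hlb
  have hunit : ∀ l : ℕ, 0 < l → l < b → IsUnit ((l : ℕ) : k) := fun l hl hlb =>
    isUnit_natCast_of_pos_of_lt (k := k) (A := k) p hl (hbp.imp id fun h => lt_trans hlb h)
  -- Step 1: the blow-up of `Z_{-1}`
  set C := boundaryCentre φ T.ideal D b with hCdef
  have hadm₀ : (CentreSeq.single C).IsAdmissibleFor (T.marked b) :=
    isAdmissibleFor_single_boundaryCentre T.hasSNC hD hXd hc hunitst hb
  obtain ⟨hCsupp, hCsnc, hCreg, -⟩ := hadm₀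
  set T₀ : Triple k 3 := T.blowupTriple hb C hCsupp hCsnc hCreg with hT₀
  haveI : IsLocallyNoetherian T₀.X := T₀.isLocallyNoetherian
  haveI : IsProper (blowup.π C) := (blowup.isBlowup C).isProper
  set π := blowup.π C with hπdef
  have hπ : IsBlowup π C := blowup.isBlowup C
  set D₀ : T₀.X.IdealSheafData := strictTransformIdeal π C D with hD₀def
  have hD₀mem : D₀ ∈ T₀.boundary := List.mem_append_left _ (List.mem_map.mpr ⟨D, hD, rfl⟩)
  have hk₀ : T₀.kHom = π.appTop.hom.comp φ := blowupTriple_kHom T hb C hCsupp hCsnc hCreg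
  have hX₀d : HasFinitePresentationDifferentials (π.appTop.hom.comp φ) :=
    T.hasFinitePresentationDifferentials_of_hom π
  have hI : T.ideal ≤ C ^ b := (T.marked b).ideal_le_pow hCsupp hCsnc
  have hne : ∀ s : D₀.subscheme, stalkIdeal ((T₀.marked b).coeffRestrict T₀.kHom D₀).ideal s ≠ ⊥ := by
    refine stalkIdeal_coeffRestrict_ne_bot T₀.kHom (T₀.marked b) hb
      (fun y hy => T₀.hasSNC.isPrime_stalkIdeal hD₀mem hy) (fun y hy => ?_)
    rw [hk₀]
    exact not_stalkIdeal_derivIdealSheafIter_transform_le T.hasSNC hD hπ hXd hX₀d hI hb hy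
  -- the surface triple `(S, 𝒞(I_0, b)|_S, (E_0 ∖ S)|_S)`
  set T₂ : Triple k 2 := T₀.hypersurfaceTriple b D₀ hD₀mem hne with hT₂
  set N := (T₀.marked b).coeffRestrict T₀.kHom D₀ with hN
  have hmult : N.mult = Nat.factorial b := MarkedIdeal.coeffRestrict_mult T₀.kHom (T₀.marked b) D₀
  have hNeq : T₂.marked (Nat.factorial b) = N := by
    rw [← hmult]
    exact rfl
  have hmaxN : T₂.MaxOrdLE μ := fun s => by
    have h := hμ s
    change idealOrder N.ideal s ≤ μ
    rw [hN, hk₀]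
    exact h
  -- Step 2: Kollár's order reduction (any marking) on the surface triple, tame
  obtain ⟨s, hs⟩ : ∃ s : CentreSeq D₀.subscheme, s.IsResolutionOf N := by
    have h := T₂.exists_isResolutionOf_marked_two' p (Nat.factorial_pos b) hmaxN hp
    rw [hNeq] at h
    exact h
  -- Step 3: going up along `S ↪ X_0`
  have hsnc₀ : HasSNC (D₀ :: (T₀.marked b).boundary) := T₀.hasSNC.cons_of_mem hD₀mem
  have hD₀gen := T₀.hasSNC.exists_generator_notMem_sq hD₀mem
  have hfp₀ : ∀ ⦃Y : Scheme.{u}⦄ (g : Y ⟶ T₀.X) [LocallyOfFiniteType g],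
      HasFinitePresentationDifferentials (g.appTop.hom.comp T₀.kHom) :=
    fun Y g _ => T₀.hasFinitePresentationDifferentials_of_hom g
  have hc₀ : HasLocalCoordinates T₀.kHom := T₀.hasLocalCoordinates_kHom_of_perfectField
  have hb₀ : 1 ≤ (T₀.marked b).mult := hb
  obtain ⟨hadm₁, hdisj⟩ := CentreSeq.support_transformMarked_pushforward_disjoint_range hfp₀ hc₀
    T₀.isRegular (T₀.marked b) hb₀ hunit hsnc₀ hD₀gen s hs
  have hrange := CentreSeq.support_transformDivisor_pushforward_eq_range hfp₀ hc₀ T₀.isRegular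
    (T₀.marked b) hb₀ hunit hsnc₀ hD₀gen s hs.1
  set u : CentreSeq T₀.X := s.pushforward D₀.subschemeι with hu
  have hfinal : ((u.transformDivisor D₀).support : Set u.top) ∩ (u.transformMarked (T₀.marked b)).support = ∅ := by
    rw [hu, hrange, Set.inter_comm]
    exact hdisj
  exact ⟨CentreSeq.cons C u, (CentreSeq.isAdmissibleFor_cons C _ _).mpr ⟨hCsupp, hCsnc, hCreg, hadm₁⟩, hfinal⟩

end Kollar2007.Triple

end Literature.AlgebraicGeometry.Resolution

end
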